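import Summits.AtomisticToContinuum.Crystallization.Theorems.FrustratedLawDichotomyHalfCap

/-!
# FrustratedLawDichotomy · crux `AperiodicFrustratedLawGap` (stmt-AtomisticToContinuum-27623) — «NO-TWIST SWAP»: the configuration
# statement «no twisted corner» for (centre `Pat`, neighbour `Pat'`) from the finite certificate `NoTwistCert θ Pat' Pat` of the SWAPPED
# pair (decomp-a2c, prover hand 2, gen 10)

P `CapForcing θ` was reduced (p822065 / p822160 / p822220) to SIX finite certificates, among them the four two-link statements
`NoTwistCert θ Pat Pat'`, `Pat, Pat' ∈ {fcc, hcp}` (centre `Pat`-classified, corner neighbour `Pat'`-classified).  The data of the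
configuration statement `noTwist_of_cert` — a site `i` with a `Pat`-classified link `τ`, a corner `τ w` with a `Pat'`-classified link
`τ'`, `τ' w' = i`, and the correspondence `C'(w') ↔ C(w)` of the four common sites — are SYMMETRIC under `i ↔ τ w`; so the certificate
of the swapped pair, `NoTwistCert θ Pat' Pat`, applied AT THE NEIGHBOUR, yields the converse transfer «`Pat'`-diagonal pairs of `C'(w')`
correspond to `Pat`-diagonal pairs of `C(w)`».  At a matching-type (`3.4.3.4`) corner the two diagonal pairs partition the corner 4-set on
both sides, so the converse transfer is equivalent to the direct one; path-type (`3².4²`) corners never face fcc corners (CORNER PAIRING I,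
p821792).  Hence:

* integer facts (by `decide`) and their transport: in fcc every contact `a` of a corner `w` has a DIAGONAL PARTNER inside `C(w)`
  (`fcc_exists_diagonal_partner`), and it is unique (`fcc_diagonal_partner_unique`); in hcp the same at matching-type corners
  (`hcp_exists_diagonal_partner`), and two distinct diagonal partners inside `C(w)` force `w` to be path-type (`hcp_pathType_of_two_diagonal_partners`);
* ★ `noTwist_of_cert_swap` — the abstract swapped corner lemma (local pattern facts as hypotheses);
* ★ `noTwist_hcp_fcc_of_cert` : `NoTwistCert θ fcc hcp ⟹` no twisted corner at an hcp-classified centre facing an fcc-classified corner;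
  `noTwist_fcc_hcp_of_cert` : `NoTwistCert θ hcp fcc ⟹` the same with the roles exchanged;
* `exists_halfCap_hcp_of_noTwist_fcc_hcp`, `exists_halfCap_fcc_of_noTwist_hcp_fcc` — the half-caps at such corners.
Consequence (next file): EITHER mixed certificate makes the other redundant — `CapForcing θ` from FIVE certificates, `KR2Shape` from EIGHT.
`[folklore]` bookkeeping; def-free; no `sorry`; no `instance`/`notation`.
-/

noncomputable section

namespace Summit.AtomisticToContinuum.Crystallization.Theorems.FrustratedLawDichotomyNoTwistSwap

open Literature.Geometry.DiscreteGeometry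
open Summit.AtomisticToContinuum.Crystallization.Theorems.FrustratedLawDichotomyTwoShellRigidityCut (E3 LinkIso)
open Summit.AtomisticToContinuum.Crystallization.Theorems.FrustratedLawDichotomyLinkIsoToolkit (injective_of_linkIso)
open Summit.AtomisticToContinuum.Crystallization.Theorems.FrustratedLawDichotomyCappedRigidityCertPatterns
  (dist_eq_one_iff_sqNormInt dist_eq_sqrt_two_iff_sqNormInt fcc_contactSeparating hcp_contactSeparating)
open Summit.AtomisticToContinuum.Crystallization.Theorems.FrustratedLawDichotomyCornerPairing
  (exists_partner ncard_common_contacts_eq_of_shared_bond ncard_common_contacts_scaledPattern exists_int_of_mem_scaledPattern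
    fcc_not_pathType not_pathType_of_fcc_neighbour)
open Summit.AtomisticToContinuum.Crystallization.Theorems.FrustratedLawDichotomyCornerPairingHalfCap (hcp_ncard_common_contacts_of_diagonal)
open Summit.AtomisticToContinuum.Crystallization.Theorems.FrustratedLawDichotomyNoTwistCert (NoTwistCert noTwist_of_cert)
open Summit.AtomisticToContinuum.Crystallization.Theorems.FrustratedLawDichotomyHalfCap
  (fcc_ncard_common_contacts_of_diagonal fcc_common_contacts_not_adj hcp_common_contacts_not_adj exists_halfCap_of_diagonal_partners)

variable {θ : ℝ} {Pat Pat' : Finset E3} {N : ℕ} {y : Fin N → E3} {i : Fin N} {τ : ↥Pat → Fin N} {τ' : ↥Pat' → Fin N}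

/-! ### §1 Integer facts (by `decide`) -/

set_option maxRecDepth 8000 in
/-- fcc (integer model): every contact `a` of a corner `w` has a diagonal partner among the contacts of `w`. [folklore] -/
theorem fccInt_exists_diagonal_partner : ∀ w ∈ fccInt, ∀ a ∈ fccInt, sqNormInt (w - a) = ((2 : ℕ) : ℤ) →
    ∃ c ∈ fccInt, sqNormInt (w - c) = ((2 : ℕ) : ℤ) ∧ sqNormInt (a - c) = 2 * ((2 : ℕ) : ℤ) := by
  decide

set_option maxRecDepth 8000 in
/-- fcc (integer model): the diagonal partner of a contact `a` of `w` inside the corner `C(w)` is unique. [folklore] -/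
theorem fccInt_diagonal_partner_unique : ∀ w ∈ fccInt, ∀ a ∈ fccInt, ∀ x ∈ fccInt, ∀ x' ∈ fccInt,
    sqNormInt (w - a) = ((2 : ℕ) : ℤ) → sqNormInt (w - x) = ((2 : ℕ) : ℤ) → sqNormInt (w - x') = ((2 : ℕ) : ℤ) →
      sqNormInt (a - x) = 2 * ((2 : ℕ) : ℤ) → sqNormInt (a - x') = 2 * ((2 : ℕ) : ℤ) → x = x' := by
  decide

set_option maxRecDepth 8000 in
/-- hcp (integer model): at a corner `w` WITHOUT an isolated contact (a matching-type corner) every contact `a` of `w` has a diagonal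
partner among the contacts of `w`. [folklore] -/
theorem hcpInt_exists_diagonal_partner : ∀ w ∈ hcpInt,
    (¬ ∃ d ∈ hcpInt, sqNormInt (w - d) = ((18 : ℕ) : ℤ) ∧
        (hcpInt.filter (fun c => sqNormInt (w - c) = ((18 : ℕ) : ℤ) ∧ sqNormInt (d - c) = ((18 : ℕ) : ℤ))).card = 0) →
      ∀ a ∈ hcpInt, sqNormInt (w - a) = ((18 : ℕ) : ℤ) →
        ∃ c ∈ hcpInt, sqNormInt (w - c) = ((18 : ℕ) : ℤ) ∧ sqNormInt (a - c) = 2 * ((18 : ℕ) : ℤ) := by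
  decide

set_option maxRecDepth 8000 in
/-- hcp (integer model): a contact `a` of `w` with two distinct diagonal partners inside `C(w)` is ISOLATED in `C(w)` (so `w` is a
path-type corner). [folklore] -/
theorem hcpInt_isolated_of_two_diagonal_partners : ∀ w ∈ hcpInt, ∀ a ∈ hcpInt, ∀ x ∈ hcpInt, ∀ x' ∈ hcpInt,
    sqNormInt (w - a) = ((18 : ℕ) : ℤ) → sqNormInt (w - x) = ((18 : ℕ) : ℤ) → sqNormInt (w - x') = ((18 : ℕ) : ℤ) →
      sqNormInt (a - x) = 2 * ((18 : ℕ) : ℤ) → sqNormInt (a - x') = 2 * ((18 : ℕ) : ℤ) → x ≠ x' →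
        (hcpInt.filter (fun c => sqNormInt (w - c) = ((18 : ℕ) : ℤ) ∧ sqNormInt (a - c) = ((18 : ℕ) : ℤ))).card = 0 := by
  decide

set_option maxRecDepth 8000 in
/-- hcp (integer model): a corner with an isolated contact has a degree-`2` contact (it is path-type). [folklore] -/
theorem hcpInt_pathType_of_isolated : ∀ w ∈ hcpInt,
    (∃ d ∈ hcpInt, sqNormInt (w - d) = ((18 : ℕ) : ℤ) ∧
        (hcpInt.filter (fun c => sqNormInt (w - c) = ((18 : ℕ) : ℤ) ∧ sqNormInt (d - c) = ((18 : ℕ) : ℤ))).card = 0) →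
      ∃ b ∈ hcpInt, sqNormInt (w - b) = ((18 : ℕ) : ℤ) ∧
        (hcpInt.filter (fun c => sqNormInt (w - c) = ((18 : ℕ) : ℤ) ∧ sqNormInt (b - c) = ((18 : ℕ) : ℤ))).card = 2 := by
  decide

/-! ### §2 Transport to the real patterns -/

/-- A member of the integer model gives a member of the scaled pattern. [folklore] -/
theorem mem_scaledPattern_of_mem {S : Finset (Fin 3 → ℤ)} {N₀ : ℕ} {c : Fin 3 → ℤ} (hc : c ∈ S) :
    ((Real.sqrt N₀)⁻¹ • intVec c : E3) ∈ scaledPattern S N₀ := by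
  simp only [scaledPattern, Finset.mem_image]
  exact ⟨c, hc, rfl⟩

/-- **fcc: every contact `a` of a corner `w` has a diagonal partner inside `C(w)`.** [folklore] -/
theorem fcc_exists_diagonal_partner (w a : ↥fccKissingPattern) (h : dist (w : E3) (a : E3) = 1) :
    ∃ c : ↥fccKissingPattern, dist (w : E3) (c : E3) = 1 ∧ dist (a : E3) (c : E3) = Real.sqrt 2 := by
  obtain ⟨w₀, hw₀, hw⟩ := exists_int_of_mem_scaledPattern w
  obtain ⟨a₀, ha₀, ha⟩ := exists_int_of_mem_scaledPattern a
  have hwa : sqNormInt (w₀ - a₀) = ((2 : ℕ) : ℤ) := by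
    rw [← hw, ← ha] at h; exact (dist_eq_one_iff_sqNormInt two_ne_zero w₀ a₀).1 h
  obtain ⟨c₀, hc₀, hwc, hac⟩ := fccInt_exists_diagonal_partner w₀ hw₀ a₀ ha₀ hwa
  refine ⟨⟨(Real.sqrt (2 : ℕ))⁻¹ • intVec c₀, mem_scaledPattern_of_mem hc₀⟩, ?_, ?_⟩
  · show dist (w : E3) ((Real.sqrt (2 : ℕ))⁻¹ • intVec c₀) = 1
    rw [← hw]; exact (dist_eq_one_iff_sqNormInt two_ne_zero w₀ c₀).2 hwc
  · show dist (a : E3) ((Real.sqrt (2 : ℕ))⁻¹ • intVec c₀) = Real.sqrt 2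
    rw [← ha]; exact (dist_eq_sqrt_two_iff_sqNormInt two_ne_zero a₀ c₀).2 hac

/-- **fcc: the diagonal partner inside a corner is unique.** [folklore] -/
theorem fcc_diagonal_partner_unique (w a x x' : ↥fccKissingPattern) (ha : dist (w : E3) (a : E3) = 1)
    (hx : dist (w : E3) (x : E3) = 1) (hx' : dist (w : E3) (x' : E3) = 1) (hax : dist (a : E3) (x : E3) = Real.sqrt 2)
    (hax' : dist (a : E3) (x' : E3) = Real.sqrt 2) : x = x' := by
  obtain ⟨w₀, hw₀, hw⟩ := exists_int_of_mem_scaledPattern w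
  obtain ⟨a₀, ha₀, hav⟩ := exists_int_of_mem_scaledPattern a
  obtain ⟨x₀, hx₀, hxv⟩ := exists_int_of_mem_scaledPattern x
  obtain ⟨x₁, hx₁, hx'v⟩ := exists_int_of_mem_scaledPattern x'
  have h1 : sqNormInt (w₀ - a₀) = ((2 : ℕ) : ℤ) := by
    rw [← hw, ← hav] at ha; exact (dist_eq_one_iff_sqNormInt two_ne_zero w₀ a₀).1 ha
  have h2 : sqNormInt (w₀ - x₀) = ((2 : ℕ) : ℤ) := by
    rw [← hw, ← hxv] at hx; exact (dist_eq_one_iff_sqNormInt two_ne_zero w₀ x₀).1 hx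
  have h3 : sqNormInt (w₀ - x₁) = ((2 : ℕ) : ℤ) := by
    rw [← hw, ← hx'v] at hx'; exact (dist_eq_one_iff_sqNormInt two_ne_zero w₀ x₁).1 hx'
  have h4 : sqNormInt (a₀ - x₀) = 2 * ((2 : ℕ) : ℤ) := by
    rw [← hav, ← hxv] at hax; exact (dist_eq_sqrt_two_iff_sqNormInt two_ne_zero a₀ x₀).1 hax
  have h5 : sqNormInt (a₀ - x₁) = 2 * ((2 : ℕ) : ℤ) := by
    rw [← hav, ← hx'v] at hax'; exact (dist_eq_sqrt_two_iff_sqNormInt two_ne_zero a₀ x₁).1 hax'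
  have key := fccInt_diagonal_partner_unique w₀ hw₀ a₀ ha₀ x₀ hx₀ x₁ hx₁ h1 h2 h3 h4 h5
  apply Subtype.ext
  rw [← hxv, ← hx'v, key]

/-- **hcp: at a corner `w` that is not path-type, every contact `a` of `w` has a diagonal partner inside `C(w)`.** [folklore] -/
theorem hcp_exists_diagonal_partner (w a : ↥hcpKissingPattern)
    (hw : ¬ ∃ b : ↥hcpKissingPattern, dist (w : E3) (b : E3) = 1 ∧
      ({c : ↥hcpKissingPattern | dist (w : E3) (c : E3) = 1} ∩ {c : ↥hcpKissingPattern | dist (b : E3) (c : E3) = 1}).ncard = 2)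
    (h : dist (w : E3) (a : E3) = 1) :
    ∃ c : ↥hcpKissingPattern, dist (w : E3) (c : E3) = 1 ∧ dist (a : E3) (c : E3) = Real.sqrt 2 := by
  have h18 : (18 : ℕ) ≠ 0 := by norm_num
  obtain ⟨w₀, hw₀, hwv⟩ := exists_int_of_mem_scaledPattern w
  obtain ⟨a₀, ha₀, hav⟩ := exists_int_of_mem_scaledPattern a
  have hwa : sqNormInt (w₀ - a₀) = ((18 : ℕ) : ℤ) := by
    rw [← hwv, ← hav] at h; exact (dist_eq_one_iff_sqNormInt h18 w₀ a₀).1 h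
  have hniso : ¬ ∃ d ∈ hcpInt, sqNormInt (w₀ - d) = ((18 : ℕ) : ℤ) ∧
      (hcpInt.filter (fun c => sqNormInt (w₀ - c) = ((18 : ℕ) : ℤ) ∧ sqNormInt (d - c) = ((18 : ℕ) : ℤ))).card = 0 := by
    intro hiso
    obtain ⟨b₀, hb₀, hwb, hcard⟩ := hcpInt_pathType_of_isolated w₀ hw₀ hiso
    refine hw ⟨⟨(Real.sqrt (18 : ℕ))⁻¹ • intVec b₀, mem_scaledPattern_of_mem hb₀⟩, ?_, ?_⟩
    · show dist (w : E3) ((Real.sqrt (18 : ℕ))⁻¹ • intVec b₀) = 1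
      rw [← hwv]; exact (dist_eq_one_iff_sqNormInt h18 w₀ b₀).2 hwb
    · rw [← ncard_common_contacts_scaledPattern h18 w ⟨(Real.sqrt (18 : ℕ))⁻¹ • intVec b₀, mem_scaledPattern_of_mem hb₀⟩ hwv rfl]
        at hcard
      exact hcard
  obtain ⟨c₀, hc₀, hwc, hac⟩ := hcpInt_exists_diagonal_partner w₀ hw₀ hniso a₀ ha₀ hwa
  refine ⟨⟨(Real.sqrt (18 : ℕ))⁻¹ • intVec c₀, mem_scaledPattern_of_mem hc₀⟩, ?_, ?_⟩
  · show dist (w : E3) ((Real.sqrt (18 : ℕ))⁻¹ • intVec c₀) = 1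
    rw [← hwv]; exact (dist_eq_one_iff_sqNormInt h18 w₀ c₀).2 hwc
  · show dist (a : E3) ((Real.sqrt (18 : ℕ))⁻¹ • intVec c₀) = Real.sqrt 2
    rw [← hav]; exact (dist_eq_sqrt_two_iff_sqNormInt h18 a₀ c₀).2 hac

/-- **hcp: two distinct diagonal partners inside a corner force the corner to be path-type.** [folklore] -/
theorem hcp_pathType_of_two_diagonal_partners (w a x x' : ↥hcpKissingPattern) (ha : dist (w : E3) (a : E3) = 1)
    (hx : dist (w : E3) (x : E3) = 1) (hx' : dist (w : E3) (x' : E3) = 1) (hax : dist (a : E3) (x : E3) = Real.sqrt 2)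
    (hax' : dist (a : E3) (x' : E3) = Real.sqrt 2) (hne : x ≠ x') :
    ∃ b : ↥hcpKissingPattern, dist (w : E3) (b : E3) = 1 ∧
      ({c : ↥hcpKissingPattern | dist (w : E3) (c : E3) = 1} ∩ {c : ↥hcpKissingPattern | dist (b : E3) (c : E3) = 1}).ncard = 2 := by
  have h18 : (18 : ℕ) ≠ 0 := by norm_num
  obtain ⟨w₀, hw₀, hwv⟩ := exists_int_of_mem_scaledPattern w
  obtain ⟨a₀, ha₀, hav⟩ := exists_int_of_mem_scaledPattern a
  obtain ⟨x₀, hx₀, hxv⟩ := exists_int_of_mem_scaledPattern x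
  obtain ⟨x₁, hx₁, hx'v⟩ := exists_int_of_mem_scaledPattern x'
  have h1 : sqNormInt (w₀ - a₀) = ((18 : ℕ) : ℤ) := by
    rw [← hwv, ← hav] at ha; exact (dist_eq_one_iff_sqNormInt h18 w₀ a₀).1 ha
  have h2 : sqNormInt (w₀ - x₀) = ((18 : ℕ) : ℤ) := by
    rw [← hwv, ← hxv] at hx; exact (dist_eq_one_iff_sqNormInt h18 w₀ x₀).1 hx
  have h3 : sqNormInt (w₀ - x₁) = ((18 : ℕ) : ℤ) := by
    rw [← hwv, ← hx'v] at hx'; exact (dist_eq_one_iff_sqNormInt h18 w₀ x₁).1 hx'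
  have h4 : sqNormInt (a₀ - x₀) = 2 * ((18 : ℕ) : ℤ) := by
    rw [← hav, ← hxv] at hax; exact (dist_eq_sqrt_two_iff_sqNormInt h18 a₀ x₀).1 hax
  have h5 : sqNormInt (a₀ - x₁) = 2 * ((18 : ℕ) : ℤ) := by
    rw [← hav, ← hx'v] at hax'; exact (dist_eq_sqrt_two_iff_sqNormInt h18 a₀ x₁).1 hax'
  have hne' : x₀ ≠ x₁ := by
    intro e; apply hne; apply Subtype.ext; rw [← hxv, ← hx'v, e]
  have hiso := hcpInt_isolated_of_two_diagonal_partners w₀ hw₀ a₀ ha₀ x₀ hx₀ x₁ hx₁ h1 h2 h3 h4 h5 hne'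
  obtain ⟨b₀, hb₀, hwb, hcard⟩ := hcpInt_pathType_of_isolated w₀ hw₀ ⟨a₀, ha₀, h1, hiso⟩
  refine ⟨⟨(Real.sqrt (18 : ℕ))⁻¹ • intVec b₀, mem_scaledPattern_of_mem hb₀⟩, ?_, ?_⟩
  · show dist (w : E3) ((Real.sqrt (18 : ℕ))⁻¹ • intVec b₀) = 1
    rw [← hwv]; exact (dist_eq_one_iff_sqNormInt h18 w₀ b₀).2 hwb
  · rw [← ncard_common_contacts_scaledPattern h18 w ⟨(Real.sqrt (18 : ℕ))⁻¹ • intVec b₀, mem_scaledPattern_of_mem hb₀⟩ hwv rfl]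
      at hcard
    exact hcard

/-! ### §3 The swapped corner lemma -/

/-- In the corner correspondence, `w'` (which indexes `i`) is in contact with every partner `a'` of a contact `a` of `w`. [folklore] -/
theorem dist_centre_partner_eq_one (hL : LinkIso θ Pat y i τ) (w : ↥Pat) (hL' : LinkIso θ Pat' y (τ w) τ') {w' : ↥Pat'}
    (hw' : τ' w' = i) {a : ↥Pat} {a' : ↥Pat'} (ha' : τ' a' = τ a) : dist (w' : E3) (a' : E3) = 1 :=
  (hL'.2.2 w' a').1 (by rw [hw', ha']; exact hL.1 a)

/-- The centre's link, re-based at the corner: `LinkIso θ Pat y (τ' w') τ`. [folklore] -/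
theorem linkIso_rebase (hL : LinkIso θ Pat y i τ) {w' : ↥Pat'} (hw' : τ' w' = i) : LinkIso θ Pat y (τ' w') τ := by
  rw [hw']; exact hL

/-- ★ **THE SWAPPED CORNER LEMMA (abstract).**  `LinkIso θ Pat y i τ`, corner `w`, neighbour `τ w` with `LinkIso θ Pat' y (τ w) τ'`,
`τ' w' = i`; sites `τ a = τ' a'`, `τ b = τ' b'`.  Hypotheses: the certificate of the SWAPPED pair `NoTwistCert θ Pat' Pat`; the local
pattern facts «`a'` has a diagonal partner inside `C'(w')`» and «every diagonal partner of `a` inside `C(w)` equals `b`» (at a matching-type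
corner: `a, b` is a `Pat`-diagonal pair of `C(w)`).  Conclusion: `a', b'` is a `Pat'`-diagonal pair.  No metric content: `noTwist_of_cert`
for the swapped pair, applied with `i ↔ τ w`. [folklore] -/
theorem noTwist_of_cert_swap
    (hPat : ∀ u v : ↥Pat, u ≠ v → ∃ c : ↥Pat, dist (u : E3) (c : E3) = 1 ∧ dist (v : E3) (c : E3) ≠ 1)
    (hPat' : ∀ u v : ↥Pat', u ≠ v → ∃ c : ↥Pat', dist (u : E3) (c : E3) = 1 ∧ dist (v : E3) (c : E3) ≠ 1)
    (hcert : NoTwistCert θ Pat' Pat) (hy : Function.Injective y)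
    (hL : LinkIso θ Pat y i τ) (w : ↥Pat) (hL' : LinkIso θ Pat' y (τ w) τ') {w' : ↥Pat'} (hw' : τ' w' = i)
    {a b : ↥Pat} {a' b' : ↥Pat'} (ha' : τ' a' = τ a) (hb' : τ' b' = τ b)
    (hF1 : ∃ c' : ↥Pat', dist (w' : E3) (c' : E3) = 1 ∧ dist (a' : E3) (c' : E3) = Real.sqrt 2)
    (hF2 : ∀ x : ↥Pat, dist (w : E3) (x : E3) = 1 → dist (a : E3) (x : E3) = Real.sqrt 2 → x = b) :
    dist (a' : E3) (b' : E3) = Real.sqrt 2 := by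
  have hτ : Function.Injective τ := injective_of_linkIso hPat hL
  have hτ' : Function.Injective τ' := injective_of_linkIso hPat' hL'
  have hLw : LinkIso θ Pat y (τ' w') τ := linkIso_rebase hL hw'
  obtain ⟨c', hc'w, hac'⟩ := hF1
  -- the partner `c ∈ C(w)` of `c'`
  obtain ⟨c, hcw, hc, -⟩ := exists_partner hτ hL' w' hLw (w' := w) rfl hc'w
  -- the swapped certificate, applied at the neighbour: `a, c` is a `Pat`-diagonal pair
  have hw'a' : dist (w' : E3) (a' : E3) = 1 := dist_centre_partner_eq_one hL w hL' hw' ha'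
  have hac : dist (a : E3) (c : E3) = Real.sqrt 2 :=
    noTwist_of_cert hPat' hPat hcert hy hL' w' hLw (w' := w) rfl hw'a' hc'w ha'.symm hc hac'
  -- uniqueness of the diagonal partner inside `C(w)`
  have hcb : c = b := hF2 c hcw hac
  have hc'b' : c' = b' := hτ' (by rw [← hc, hcb, hb'])
  rw [← hc'b']; exact hac'

/-! ### §4 The two mixed pairs -/

/-- ★ **No twisted corner at an hcp-classified centre facing an fcc-classified corner, from `NoTwistCert θ fcc hcp`.** [folklore] -/
theorem noTwist_hcp_fcc_of_cert (hcert : NoTwistCert θ fccKissingPattern hcpKissingPattern)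
    {τ : ↥hcpKissingPattern → Fin N} {τ' : ↥fccKissingPattern → Fin N} (hy : Function.Injective y)
    (hL : LinkIso θ hcpKissingPattern y i τ) (w : ↥hcpKissingPattern) (hL' : LinkIso θ fccKissingPattern y (τ w) τ')
    {w' : ↥fccKissingPattern} (hw' : τ' w' = i) {a b : ↥hcpKissingPattern} {a' b' : ↥fccKissingPattern}
    (ha : dist (w : E3) (a : E3) = 1) (hb : dist (w : E3) (b : E3) = 1) (ha' : τ' a' = τ a) (hb' : τ' b' = τ b)
    (hab : dist (a : E3) (b : E3) = Real.sqrt 2) : dist (a' : E3) (b' : E3) = Real.sqrt 2 := by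
  have hτ : Function.Injective τ := injective_of_linkIso hcp_contactSeparating hL
  have hτ' : Function.Injective τ' := injective_of_linkIso fcc_contactSeparating hL'
  refine noTwist_of_cert_swap hcp_contactSeparating fcc_contactSeparating hcert hy hL w hL' hw' ha' hb'
    (fcc_exists_diagonal_partner w' a' (dist_centre_partner_eq_one hL w hL' hw' ha')) ?_
  intro x hwx hax
  by_contra hne
  obtain ⟨b₀, hb₀, hdeg2⟩ := hcp_pathType_of_two_diagonal_partners w a x b ha hwx hb hax hab hne
  exact not_pathType_of_fcc_neighbour hτ hτ' hL w hL' hw' hb₀ hdeg2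

/-- ★ **No twisted corner at an fcc-classified centre facing an hcp-classified corner, from `NoTwistCert θ hcp fcc`.** [folklore] -/
theorem noTwist_fcc_hcp_of_cert (hcert : NoTwistCert θ hcpKissingPattern fccKissingPattern)
    {τ : ↥fccKissingPattern → Fin N} {τ' : ↥hcpKissingPattern → Fin N} (hy : Function.Injective y)
    (hL : LinkIso θ fccKissingPattern y i τ) (w : ↥fccKissingPattern) (hL' : LinkIso θ hcpKissingPattern y (τ w) τ')
    {w' : ↥hcpKissingPattern} (hw' : τ' w' = i) {a b : ↥fccKissingPattern} {a' b' : ↥hcpKissingPattern}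
    (ha : dist (w : E3) (a : E3) = 1) (hb : dist (w : E3) (b : E3) = 1) (ha' : τ' a' = τ a) (hb' : τ' b' = τ b)
    (hab : dist (a : E3) (b : E3) = Real.sqrt 2) : dist (a' : E3) (b' : E3) = Real.sqrt 2 := by
  have hτ : Function.Injective τ := injective_of_linkIso fcc_contactSeparating hL
  have hτ' : Function.Injective τ' := injective_of_linkIso hcp_contactSeparating hL'
  have hLw : LinkIso θ fccKissingPattern y (τ' w') τ := linkIso_rebase hL hw'
  -- the corner `w'` of the hcp neighbour is not path-type: a degree-2 contact would transfer to the fcc corner `w`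
  have hw'np : ¬ ∃ b₀ : ↥hcpKissingPattern, dist (w' : E3) (b₀ : E3) = 1 ∧
      ({c : ↥hcpKissingPattern | dist (w' : E3) (c : E3) = 1} ∩ {c : ↥hcpKissingPattern | dist (b₀ : E3) (c : E3) = 1}).ncard = 2 := by
    rintro ⟨b₀, hb₀, hdeg2⟩
    obtain ⟨b₁, hb₁w, hb₁, -⟩ := exists_partner hτ hL' w' hLw (w' := w) rfl hb₀
    refine fcc_not_pathType w ⟨b₁, hb₁w, ?_⟩
    rw [← ncard_common_contacts_eq_of_shared_bond hτ' hτ hL' w' hLw (w' := w) rfl hb₁]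
    exact hdeg2
  exact noTwist_of_cert_swap fcc_contactSeparating hcp_contactSeparating hcert hy hL w hL' hw' ha' hb'
    (hcp_exists_diagonal_partner w' a' hw'np (dist_centre_partner_eq_one hL w hL' hw' ha'))
    (fun x hwx hax => fcc_diagonal_partner_unique w a x b ha hwx hb hax hab)

/-! ### §5 The half-caps at mixed corners -/

/-- **The half-cap at a corner of an hcp-classified centre whose neighbour is fcc-classified, from `NoTwistCert θ fcc hcp`.** [folklore] -/
theorem exists_halfCap_hcp_of_noTwist_fcc_hcp (hcert : NoTwistCert θ fccKissingPattern hcpKissingPattern)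
    {τ : ↥hcpKissingPattern → Fin N} {τ' : ↥fccKissingPattern → Fin N} (hy : Function.Injective y)
    (hL : LinkIso θ hcpKissingPattern y i τ) (w : ↥hcpKissingPattern) (hL' : LinkIso θ fccKissingPattern y (τ w) τ')
    {w' : ↥fccKissingPattern} (hw' : τ' w' = i) {a b : ↥hcpKissingPattern} (ha : dist (w : E3) (a : E3) = 1)
    (hb : dist (w : E3) (b : E3) = 1) (hab : dist (a : E3) (b : E3) = Real.sqrt 2) :
    ∃ m : Fin N, m ≠ i ∧ (bondGraph θ y).Adj m (τ a) ∧ (bondGraph θ y).Adj m (τ b) ∧ (bondGraph θ y).Adj m (τ w) ∧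
      m ∉ Set.range τ := by
  have hτ' : Function.Injective τ' := injective_of_linkIso fcc_contactSeparating hL'
  obtain ⟨a', ha'w, ha', -⟩ := exists_partner hτ' hL w hL' hw' ha
  obtain ⟨b', hb'w, hb', -⟩ := exists_partner hτ' hL w hL' hw' hb
  have hdiag : dist (a' : E3) (b' : E3) = Real.sqrt 2 := noTwist_hcp_fcc_of_cert hcert hy hL w hL' hw' ha hb ha' hb' hab
  exact exists_halfCap_of_diagonal_partners hτ' hL w hL' hw' ha'w hb'w ha' hb' hdiag
    (fcc_ncard_common_contacts_of_diagonal a' b' hdiag)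
    (fun c c' h1 h2 h3 h4 hne => fcc_common_contacts_not_adj a' b' c c' hdiag h1 h2 h3 h4 hne)

/-- **The half-cap at a corner of an fcc-classified centre whose neighbour is hcp-classified, from `NoTwistCert θ hcp fcc`.** [folklore] -/
theorem exists_halfCap_fcc_of_noTwist_hcp_fcc (hcert : NoTwistCert θ hcpKissingPattern fccKissingPattern)
    {τ : ↥fccKissingPattern → Fin N} {τ' : ↥hcpKissingPattern → Fin N} (hy : Function.Injective y)
    (hL : LinkIso θ fccKissingPattern y i τ) (w : ↥fccKissingPattern) (hL' : LinkIso θ hcpKissingPattern y (τ w) τ')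
    {w' : ↥hcpKissingPattern} (hw' : τ' w' = i) {a b : ↥fccKissingPattern} (ha : dist (w : E3) (a : E3) = 1)
    (hb : dist (w : E3) (b : E3) = 1) (hab : dist (a : E3) (b : E3) = Real.sqrt 2) :
    ∃ m : Fin N, m ≠ i ∧ (bondGraph θ y).Adj m (τ a) ∧ (bondGraph θ y).Adj m (τ b) ∧ (bondGraph θ y).Adj m (τ w) ∧
      m ∉ Set.range τ := by
  have hτ' : Function.Injective τ' := injective_of_linkIso hcp_contactSeparating hL'
  obtain ⟨a', ha'w, ha', -⟩ := exists_partner hτ' hL w hL' hw' ha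
  obtain ⟨b', hb'w, hb', -⟩ := exists_partner hτ' hL w hL' hw' hb
  have hdiag : dist (a' : E3) (b' : E3) = Real.sqrt 2 := noTwist_fcc_hcp_of_cert hcert hy hL w hL' hw' ha hb ha' hb' hab
  exact exists_halfCap_of_diagonal_partners hτ' hL w hL' hw' ha'w hb'w ha' hb' hdiag
    (hcp_ncard_common_contacts_of_diagonal a' b' hdiag)
    (fun c c' h1 h2 h3 h4 hne => hcp_common_contacts_not_adj a' b' c c' hdiag h1 h2 h3 h4 hne)

end Summit.AtomisticToContinuum.Crystallization.Theorems.FrustratedLawDichotomyNoTwistSwap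

end
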